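import Literature.RepresentationTheory.FiniteGroups.SymmetricGroupCosetSpan
import Literature.NumberTheory.DiophantineGeometry.SymmetricGroupCharacterProjectors
import HarnessLib

/-!
# Ellis–Friedgut–Pilpel, Theorem 7: `V_k` is the span of the `k`-cosets — proof

This file discharges the named fact
`Literature.RepresentationTheory.FiniteGroups.EllisFriedgutPilpel2011_thm7` of
`SymmetricGroupCosetSpan.lean`: for `k ≤ n`, the space `V_k` (`efpV n k`) of functions
`f : 𝔖ₙ → ℂ` whose Fourier transform `f̂([μ]) = ∑_σ f(σ) ρ_μ(σ)` vanishes on every Specht module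
`S^μ = ℂ[𝔖ₙ] c_μ` with `μ₁ < n - k` equals the span `kCosetSpan n k` of the characteristic
functions of the `k`-cosets `T_{a ↦ b} = {σ | σ ∘ a = b}`
(D. Ellis, E. Friedgut, H. Pilpel, *Intersecting families of permutations*, J. Amer. Math. Soc.
24 (2011), §1.2 Theorem 7, proved in §3.2.3).

## The proof

We follow the "alternative proof, for the more algebraically minded reader" printed at the end
of §3.2.3, which works inside the group algebra `A = ℂ[𝔖ₙ]`: identify a function `f` with
`z_f = ∑_σ f(σ) σ ∈ A`, so that `f̂([μ]) = 0` says that `z_f` annihilates the left ideal `S^μ`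
(`coe_fourierSpecht_apply`), and the indicator of `T_{a ↦ b}` becomes the coset sum
`[T_{a ↦ b}] = ∑_{σ ∘ a = b} σ` (`sum_indicator_kCoset_smul_of`). No definitions are introduced:
the coset sums `∑_{σ ∘ a = b} σ`, the sums `[Fix C] = ∑_{σ|_C = id} σ` over pointwise stabilisers
and the set of all `k`-coset sums are written out.

* The span `V` of the coset sums is a two-sided ideal ("the sum of all right translates of `W`"):
  `g · [T_{a ↦ b}] = [T_{a ↦ g ∘ b}]` and `[T_{a ↦ b}] · g = [T_{g⁻¹ ∘ a ↦ b}]`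
  (`of_mul_cosetSum`, `cosetSum_mul_of`, `mul_mem_span_cosetSums`, `mul_mem_span_cosetSums_right`).
* `V ≤ V_k` ("`W ≤ V_k`", for which the paper invokes Young's rule / the branching rule): a
  nonempty `k`-coset is `[T] = [Fix C] · π` with `C = im b`, `|C| = k`, and
  `[Fix C] · x · b_μ = 0` for all `x` as soon as `μ₁ < n - k` — two of the `n - k` points moved by
  `Fix C` must lie in one column of `g T_μ`, since the canonical tableau of `μ` has `μ₁` columns,
  and then the transposition trick of Fulton–Harris, Lemma 4.23 (1) applies
  (`fixSum_mul_mul_colAntisymmetrizer_eq_zero`). Hence `[T]` kills `S^μ = A a_μ b_μ`.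
* `V_k ≤ V` ("`V_{[λ]} ≤ V` for all `λ ≥ (n-k,1^k)`"): by Maschke's theorem `A` is the sum of its
  minimal left ideals `m` (Mathlib's `IsSemisimpleModule.sSup_simples_eq_top`), each isomorphic to
  some `S^μ` (completeness, the tree's `exists_equiv_spechtRep_of_isIrreducible_holds`). If
  `μ₁ < n - k`, an element of `V_k` kills `S^μ`, hence `m`. If `μ₁ ≥ n - k`, choose `n - k`
  entries `B` of the first row of `T_μ` and `C = Bᶜ`; then `Fix C ≤ R_μ`, so
  `[Fix C] c_μ = |Fix C| c_μ ≠ 0` (`c_μ ≠ 0`, the tree's `youngSymmetrizer_ne_zero_holds`), so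
  `[Fix C]` — itself a `k`-coset sum — does not kill `m ≅ S^μ`; a nonzero element `[Fix C] v`,
  `v ∈ m`, lies in `m ∩ AV`, and `m` being minimal, `m ⊆ AV = V`. So `z = z · 1 ∈ V` for every
  `z ∈ V_k` (`efpV_le_kCosetSpan`).

Intertwining maps between representations given by left multiplication are `A`-linear
(`intertwiningMap_map_smul`), which transports "`z` acts as zero / nonzero" along `m ≅ S^μ`
(the paper's "isomorphic submodules of `ℝ[G]`").

## References

* [EllisFriedgutPilpel2011] D. Ellis, E. Friedgut, H. Pilpel, *Intersecting families of
  permutations*, J. Amer. Math. Soc. 24 (2011) 649–682 = arXiv:1011.3342, §1.2 Thm. 7,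
  §3.2.3 (Def. 12, proof of Thm. 7 and the "alternative proof").
* [FultonHarrisGTM129] W. Fulton, J. Harris, *Representation Theory. A First Course*, GTM 129,
  Lemma 4.21 (1), Lemma 4.23 (1) (the transposition trick), Theorem 4.3 (completeness of the
  Specht modules).
-/

noncomputable section

open scoped BigOperators

namespace Literature.RepresentationTheory.FiniteGroups

open Literature.NumberTheory.DiophantineGeometry

namespace EllisFriedgutPilpel2011

variable {n k : ℕ}

/-! ### Coset sums and stabiliser sums in the group algebra -/

/-- `[Fix C] · t = [Fix C]` for `t` fixing `C` pointwise (`[Fix C] = ∑_{σ|_C = id} σ`).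
[folklore] -/
theorem fixSum_mul_of (C : Finset (Fin n)) {t : Equiv.Perm (Fin n)} (ht : ∀ x ∈ C, t x = x) :
    (∑ σ ∈ Finset.univ.filter (fun σ : Equiv.Perm (Fin n) => ∀ x ∈ C, σ x = x),
        MonoidAlgebra.of ℂ _ σ) * MonoidAlgebra.of ℂ _ t =
      ∑ σ ∈ Finset.univ.filter (fun σ : Equiv.Perm (Fin n) => ∀ x ∈ C, σ x = x),
        MonoidAlgebra.of ℂ _ σ := by
  rw [Finset.sum_mul]
  refine Finset.sum_equiv (Equiv.mulRight t) (fun σ => ?_) (fun σ _ => ?_)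
  · simp only [Equiv.coe_mulRight, Finset.mem_filter, Finset.mem_univ, true_and,
      Equiv.Perm.mul_apply]
    exact forall₂_congr fun x hx => by rw [ht x hx]
  · rw [Equiv.coe_mulRight, map_mul]

/-- A nonempty `k`-coset is a translate of a pointwise stabiliser:
`[T_{a ↦ b}] = [Fix (im b)] · π` for any `π ∈ T_{a ↦ b}` (Ellis–Friedgut–Pilpel, §1: "a coset of
the stabilizer of `k` points"). [cite: EllisFriedgutPilpel2011, §1 (k-cosets)] -/
theorem cosetSum_eq_fixSum_mul_of (a b : Fin k ↪ Fin n) {π : Equiv.Perm (Fin n)}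
    (hπ : ∀ i, π (a i) = b i) :
    ∑ σ ∈ Finset.univ.filter (fun σ : Equiv.Perm (Fin n) => ∀ i, σ (a i) = b i),
        MonoidAlgebra.of ℂ _ σ =
      (∑ σ ∈ Finset.univ.filter (fun σ : Equiv.Perm (Fin n) => ∀ x ∈ Finset.univ.map b, σ x = x),
        MonoidAlgebra.of ℂ _ σ) * MonoidAlgebra.of ℂ _ π := by
  rw [Finset.sum_mul]
  symm
  refine Finset.sum_equiv (Equiv.mulRight π) (fun σ => ?_) (fun σ _ => ?_)
  · simp only [Equiv.coe_mulRight, Finset.mem_filter, Finset.mem_univ, true_and,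
      Finset.forall_mem_map, Equiv.Perm.mul_apply, hπ, forall_const]
  · rw [Equiv.coe_mulRight, map_mul]

/-- Left translates of coset sums are coset sums: `g · [T_{a ↦ b}] = [T_{a ↦ g ∘ b}]`.
[cite: EllisFriedgutPilpel2011, §3.2.3 (proof of Thm. 7: double translation)] -/
theorem of_mul_cosetSum (a b : Fin k ↪ Fin n) (g : Equiv.Perm (Fin n)) :
    MonoidAlgebra.of ℂ _ g *
        ∑ σ ∈ Finset.univ.filter (fun σ : Equiv.Perm (Fin n) => ∀ i, σ (a i) = b i),
          MonoidAlgebra.of ℂ _ σ =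
      ∑ σ ∈ Finset.univ.filter
          (fun σ : Equiv.Perm (Fin n) => ∀ i, σ (a i) = b.trans g.toEmbedding i),
        MonoidAlgebra.of ℂ _ σ := by
  rw [Finset.mul_sum]
  refine Finset.sum_equiv (Equiv.mulLeft g) (fun σ => ?_) (fun σ _ => ?_)
  · simp only [Equiv.coe_mulLeft, Finset.mem_filter, Finset.mem_univ, true_and,
      Equiv.Perm.mul_apply, Function.Embedding.trans_apply, Equiv.coe_toEmbedding,
      EmbeddingLike.apply_eq_iff_eq]
  · rw [Equiv.coe_mulLeft, map_mul]

/-- Right translates of coset sums are coset sums: `[T_{a ↦ b}] · g = [T_{g⁻¹ ∘ a ↦ b}]`.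
[cite: EllisFriedgutPilpel2011, §3.2.3 (proof of Thm. 7: double translation)] -/
theorem cosetSum_mul_of (a b : Fin k ↪ Fin n) (g : Equiv.Perm (Fin n)) :
    (∑ σ ∈ Finset.univ.filter (fun σ : Equiv.Perm (Fin n) => ∀ i, σ (a i) = b i),
        MonoidAlgebra.of ℂ _ σ) * MonoidAlgebra.of ℂ _ g =
      ∑ σ ∈ Finset.univ.filter
          (fun σ : Equiv.Perm (Fin n) => ∀ i, σ (a.trans g⁻¹.toEmbedding i) = b i),
        MonoidAlgebra.of ℂ _ σ := by
  rw [Finset.sum_mul]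
  refine Finset.sum_equiv (Equiv.mulRight g) (fun σ => ?_) (fun σ _ => ?_)
  · simp only [Equiv.coe_mulRight, Finset.mem_filter, Finset.mem_univ, true_and,
      Equiv.Perm.mul_apply, Function.Embedding.trans_apply, Equiv.coe_toEmbedding,
      Equiv.Perm.coe_inv, Equiv.apply_symm_apply]
  · rw [Equiv.coe_mulRight, map_mul]

/-- The span `V` of the `k`-coset sums is a left ideal of `ℂ[𝔖ₙ]`.
[cite: EllisFriedgutPilpel2011, §3.2.3 (alternative proof: `V` is a two-sided ideal)] -/
theorem mul_mem_span_cosetSums (x : MonoidAlgebra ℂ (Equiv.Perm (Fin n)))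
    {y : MonoidAlgebra ℂ (Equiv.Perm (Fin n))}
    (hy : y ∈ Submodule.span ℂ {x : MonoidAlgebra ℂ (Equiv.Perm (Fin n)) | ∃ a b : Fin k ↪ Fin n,
      x = ∑ σ ∈ Finset.univ.filter (fun σ : Equiv.Perm (Fin n) => ∀ i, σ (a i) = b i),
        MonoidAlgebra.of ℂ _ σ}) :
    x * y ∈ Submodule.span ℂ {x : MonoidAlgebra ℂ (Equiv.Perm (Fin n)) | ∃ a b : Fin k ↪ Fin n,
      x = ∑ σ ∈ Finset.univ.filter (fun σ : Equiv.Perm (Fin n) => ∀ i, σ (a i) = b i),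
        MonoidAlgebra.of ℂ _ σ} := by
  induction x using MonoidAlgebra.induction_on with
  | hM g =>
    induction hy using Submodule.span_induction with
    | mem u hu =>
      obtain ⟨a, b, rfl⟩ := hu
      rw [of_mul_cosetSum]
      exact Submodule.subset_span ⟨a, b.trans g.toEmbedding, rfl⟩
    | zero => rw [mul_zero]; exact zero_mem _
    | add u v _ _ hu hv => rw [mul_add]; exact add_mem hu hv
    | smul c u _ hu => rw [mul_smul_comm]; exact Submodule.smul_mem _ c hu
  | hadd p q hp hq => rw [add_mul]; exact add_mem hp hq
  | hsmul r p hp => rw [smul_mul_assoc]; exact Submodule.smul_mem _ r hp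

/-- The span `V` of the `k`-coset sums is a right ideal of `ℂ[𝔖ₙ]` ("the sum of all right
translates of `W`").
[cite: EllisFriedgutPilpel2011, §3.2.3 (alternative proof: `V` is a two-sided ideal)] -/
theorem mul_mem_span_cosetSums_right (x : MonoidAlgebra ℂ (Equiv.Perm (Fin n)))
    {y : MonoidAlgebra ℂ (Equiv.Perm (Fin n))}
    (hy : y ∈ Submodule.span ℂ {x : MonoidAlgebra ℂ (Equiv.Perm (Fin n)) | ∃ a b : Fin k ↪ Fin n,
      x = ∑ σ ∈ Finset.univ.filter (fun σ : Equiv.Perm (Fin n) => ∀ i, σ (a i) = b i),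
        MonoidAlgebra.of ℂ _ σ}) :
    y * x ∈ Submodule.span ℂ {x : MonoidAlgebra ℂ (Equiv.Perm (Fin n)) | ∃ a b : Fin k ↪ Fin n,
      x = ∑ σ ∈ Finset.univ.filter (fun σ : Equiv.Perm (Fin n) => ∀ i, σ (a i) = b i),
        MonoidAlgebra.of ℂ _ σ} := by
  induction x using MonoidAlgebra.induction_on with
  | hM g =>
    induction hy using Submodule.span_induction with
    | mem u hu =>
      obtain ⟨a, b, rfl⟩ := hu
      rw [cosetSum_mul_of]
      exact Submodule.subset_span ⟨a.trans g⁻¹.toEmbedding, b, rfl⟩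
    | zero => rw [zero_mul]; exact zero_mem _
    | add u v _ _ hu hv => rw [add_mul]; exact add_mem hu hv
    | smul c u _ hu => rw [smul_mul_assoc]; exact Submodule.smul_mem _ c hu
  | hadd p q hp hq => rw [mul_add]; exact add_mem hp hq
  | hsmul r p hp => rw [mul_smul_comm]; exact Submodule.smul_mem _ r hp

/-- The left ideal `AV` generated by the `k`-coset sums has the same elements as their `ℂ`-span
`V` (which is already a left ideal). [folklore] -/
theorem mem_ideal_span_cosetSums_iff {x : MonoidAlgebra ℂ (Equiv.Perm (Fin n))} :
    x ∈ Ideal.span {x : MonoidAlgebra ℂ (Equiv.Perm (Fin n)) | ∃ a b : Fin k ↪ Fin n,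
      x = ∑ σ ∈ Finset.univ.filter (fun σ : Equiv.Perm (Fin n) => ∀ i, σ (a i) = b i),
        MonoidAlgebra.of ℂ _ σ} ↔
    x ∈ Submodule.span ℂ {x : MonoidAlgebra ℂ (Equiv.Perm (Fin n)) | ∃ a b : Fin k ↪ Fin n,
      x = ∑ σ ∈ Finset.univ.filter (fun σ : Equiv.Perm (Fin n) => ∀ i, σ (a i) = b i),
        MonoidAlgebra.of ℂ _ σ} := by
  constructor
  · intro hx
    change x ∈ Submodule.span _ _ at hx
    induction hx using Submodule.span_induction with
    | mem y hy => exact Submodule.subset_span hy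
    | zero => exact zero_mem _
    | add y z _ _ hy hz => exact add_mem hy hz
    | smul a y _ hy => exact mul_mem_span_cosetSums a hy
  · intro hx
    exact Submodule.span_le_restrictScalars ℂ _ _ hx

/-- The coefficients of `z_f = ∑_σ f(σ) σ` are the values of `f`. [folklore] -/
theorem coeff_sum_smul_of (f : Equiv.Perm (Fin n) → ℂ) (τ : Equiv.Perm (Fin n)) :
    (∑ σ : Equiv.Perm (Fin n), f σ • MonoidAlgebra.of ℂ _ σ).coeff τ = f τ := by
  classical
  simp only [MonoidAlgebra.coeff_sum, MonoidAlgebra.coeff_smul, MonoidAlgebra.of_apply,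
    MonoidAlgebra.coeff_single, Finsupp.coe_finsetSum, Finsupp.coe_smul, Finset.sum_apply,
    Pi.smul_apply, Finsupp.single_apply, smul_eq_mul, mul_ite, mul_one, mul_zero,
    Finset.sum_ite_eq', Finset.mem_univ, if_true]

/-- The element `z_f` of `ℂ[𝔖ₙ]` attached to the indicator `f = 1_{T_{a ↦ b}}` is the coset sum
`[T_{a ↦ b}]`. [folklore] -/
theorem sum_indicator_kCoset_smul_of (a b : Fin k ↪ Fin n) :
    ∑ σ : Equiv.Perm (Fin n), (kCoset a b).indicator (1 : Equiv.Perm (Fin n) → ℂ) σ •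
        MonoidAlgebra.of ℂ _ σ =
      ∑ σ ∈ Finset.univ.filter (fun σ : Equiv.Perm (Fin n) => ∀ i, σ (a i) = b i),
        MonoidAlgebra.of ℂ _ σ := by
  classical
  rw [Finset.sum_filter]
  refine Finset.sum_congr rfl fun σ _ => ?_
  by_cases h : ∀ i, σ (a i) = b i
  · rw [if_pos h, Set.indicator_of_mem (show σ ∈ kCoset a b from h), Pi.one_apply, one_smul]
  · rw [if_neg h, Set.indicator_of_notMem (show σ ∉ kCoset a b from h), zero_smul]

/-- The Fourier transform at `[μ]` is left multiplication by `z_f = ∑_σ f(σ) σ` on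
`S^μ = ℂ[𝔖ₙ] c_μ` (Ellis–Friedgut–Pilpel §2.2, `f̂(ρ) = ∑_s f(s) ρ(s)` up to the factor
`1/|G|`). [cite: EllisFriedgutPilpel2011, §2.2] -/
theorem coe_fourierSpecht_apply (f : Equiv.Perm (Fin n) → ℂ) (μ : Nat.Partition n)
    (w : spechtIdeal ℂ μ) :
    ((fourierSpecht f μ w : spechtIdeal ℂ μ) : MonoidAlgebra ℂ (Equiv.Perm (Fin n))) =
      (∑ σ : Equiv.Perm (Fin n), f σ • MonoidAlgebra.of ℂ _ σ) * w := by
  simp only [fourierSpecht, LinearMap.sum_apply, LinearMap.smul_apply, Submodule.coe_sum,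
    Submodule.coe_smul_of_tower, spechtRep_apply, Finset.sum_mul, smul_mul_assoc]

/-! ### `V ≤ V_k`: coset sums kill the Specht modules `S^μ` with `μ₁ < n - k` -/

/-- Every column index of the canonical tableau of `μ` is `< μ₁ = μ.parts.sup` (the tableau has
`μ₁` columns). [folklore] -/
theorem colOf_lt_sup (μ : Nat.Partition n) (j : Fin n) : μ.colOf j < μ.parts.sup := by
  obtain ⟨hr, hc⟩ := (μ.mem_youngDiagram_iff _).1 (μ.rowOf_colOf_mem_youngDiagram j)
  refine lt_of_lt_of_le hc (Multiset.le_sup ?_)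
  exact (Multiset.mem_sort _).1 (List.getElem_mem hr)

/-- **The transposition trick** (Fulton–Harris, Lemma 4.23 (1), proof) for a pointwise
stabiliser: if `x ≠ y` are not in `C` and `g⁻¹ x, g⁻¹ y` lie in one column of `T_μ`, then
`[Fix C] · g · b_μ = 0`: with `t = (x y) ∈ Fix C` and `t' = g⁻¹ t g ∈ C_μ`,
`[Fix C] g b_μ = [Fix C] t g b_μ = [Fix C] g t' b_μ = -[Fix C] g b_μ`.
[cite: FultonHarrisGTM129, Lemma 4.23 (1) (proof)] -/
theorem fixSum_mul_of_mul_colAntisymmetrizer_eq_zero (C : Finset (Fin n)) {μ : Nat.Partition n}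
    {g : Equiv.Perm (Fin n)} {x y : Fin n} (hxy : x ≠ y) (hx : x ∉ C) (hy : y ∉ C)
    (hcol : μ.colOf (g⁻¹ x) = μ.colOf (g⁻¹ y)) :
    (∑ σ ∈ Finset.univ.filter (fun σ : Equiv.Perm (Fin n) => ∀ x ∈ C, σ x = x),
        MonoidAlgebra.of ℂ _ σ) * MonoidAlgebra.of ℂ _ g * colAntisymmetrizer ℂ μ = 0 := by
  set F := ∑ σ ∈ Finset.univ.filter (fun σ : Equiv.Perm (Fin n) => ∀ x ∈ C, σ x = x),
    MonoidAlgebra.of ℂ (Equiv.Perm (Fin n)) σ with hF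
  set X := F * MonoidAlgebra.of ℂ _ g * colAntisymmetrizer ℂ μ with hX
  have ht : ∀ z ∈ C, Equiv.swap x y z = z := fun z hz =>
    Equiv.swap_apply_of_ne_of_ne (fun h => hx (h ▸ hz)) (fun h => hy (h ▸ hz))
  have ht' : Equiv.swap (g⁻¹ x) (g⁻¹ y) ∈ colStabilizer μ := swap_mem_colStabilizer μ hcol
  have hsgn : Equiv.Perm.sign (Equiv.swap (g⁻¹ x) (g⁻¹ y)) = -1 :=
    Equiv.Perm.sign_swap (g⁻¹.injective.ne hxy)
  have hneg : X = -X := by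
    calc X = F * MonoidAlgebra.of ℂ _ (Equiv.swap x y) *
          MonoidAlgebra.of ℂ _ g * colAntisymmetrizer ℂ μ := by
          rw [hF, fixSum_mul_of C ht]
      _ = F * MonoidAlgebra.of ℂ _ g *
          (MonoidAlgebra.of ℂ _ (Equiv.swap (g⁻¹ x) (g⁻¹ y)) * colAntisymmetrizer ℂ μ) := by
          rw [mul_assoc F, ← map_mul, Equiv.swap_mul_eq_mul_swap, map_mul]
          simp only [mul_assoc]
      _ = -X := by
          rw [of_mul_colAntisymmetrizer ht', hsgn, Units.val_neg, Units.val_one, Int.cast_neg,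
            Int.cast_one, mul_smul_comm, neg_smul, one_smul]
  have h2 : (2 : ℂ) • X = 0 := by
    rw [two_smul]
    nth_rewrite 2 [hneg]
    exact add_neg_cancel X
  calc X = (2 : ℂ)⁻¹ • ((2 : ℂ) • X) := (inv_smul_smul₀ two_ne_zero X).symm
    _ = 0 := by rw [h2, smul_zero]

/-- **`[Fix C] · z · b_μ = 0` for all `z` when `μ₁ < n - |C|`** (Ellis–Friedgut–Pilpel, proof of
Thm. 7, first half: `1_T ∈ V_k`, i.e. `1̂_T(ρ) = 0` for `ρ < (n-k,1^k)`; there via the branching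
rule, here via Fulton–Harris Lemma 4.23 (1)): the canonical tableau of `μ` has `μ₁` columns, so
for every `g` two of the `n - |C|` points outside `C` lie in one column of `g T_μ` (pigeonhole),
and the transposition trick applies; then extend linearly in `z`.
[cite: EllisFriedgutPilpel2011, §3.2.3 (proof of Thm. 7)] -/
theorem fixSum_mul_mul_colAntisymmetrizer_eq_zero (C : Finset (Fin n)) {μ : Nat.Partition n}
    (hμ : μ.parts.sup < n - C.card) (z : MonoidAlgebra ℂ (Equiv.Perm (Fin n))) :
    (∑ σ ∈ Finset.univ.filter (fun σ : Equiv.Perm (Fin n) => ∀ x ∈ C, σ x = x),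
        MonoidAlgebra.of ℂ _ σ) * z * colAntisymmetrizer ℂ μ = 0 := by
  have key : ∀ g : Equiv.Perm (Fin n), ∃ x y : Fin n, x ≠ y ∧ x ∉ C ∧ y ∉ C ∧
      μ.colOf (g⁻¹ x) = μ.colOf (g⁻¹ y) := by
    intro g
    have hc : (Finset.range μ.parts.sup).card < Cᶜ.card := by
      rw [Finset.card_range, Finset.card_compl, Fintype.card_fin]
      exact hμ
    obtain ⟨x, hx, y, hy, hxy, h⟩ := Finset.exists_ne_map_eq_of_card_lt_of_maps_to hc
      (f := fun x => μ.colOf (g⁻¹ x)) fun x _ => Finset.mem_range.2 (colOf_lt_sup μ _)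
    exact ⟨x, y, hxy, Finset.mem_compl.1 hx, Finset.mem_compl.1 hy, h⟩
  induction z using MonoidAlgebra.induction_on with
  | hM g =>
    obtain ⟨x, y, hxy, hx, hy, hcol⟩ := key g
    exact fixSum_mul_of_mul_colAntisymmetrizer_eq_zero C hxy hx hy hcol
  | hadd p q hp hq => rw [mul_add, add_mul, hp, hq, add_zero]
  | hsmul r p hp => rw [mul_smul_comm, smul_mul_assoc, hp, smul_zero]

/-- **`V ≤ V_k`**: the characteristic function of every `k`-coset lies in `V_k`
(Ellis–Friedgut–Pilpel, proof of Thm. 7, first half): `1̂_T([μ])` is left multiplication by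
`[T] = [Fix (im b)] π` on `S^μ = ℂ[𝔖ₙ] a_μ b_μ`, and `[Fix (im b)] · x · b_μ = 0` for `μ₁ < n - k`.
[cite: EllisFriedgutPilpel2011, §3.2.3 (proof of Thm. 7)] -/
theorem kCosetSpan_le_efpV (n k : ℕ) : kCosetSpan n k ≤ efpV n k := by
  refine Submodule.span_le.2 ?_
  rintro _ ⟨a, b, rfl⟩
  change (kCoset a b).indicator 1 ∈ efpV n k
  rw [mem_efpV_iff]
  intro μ hμ
  apply LinearMap.ext
  intro w
  apply Subtype.ext
  rw [coe_fourierSpecht_apply, sum_indicator_kCoset_smul_of, LinearMap.zero_apply,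
    Submodule.coe_zero]
  by_cases hT : ∃ π : Equiv.Perm (Fin n), ∀ i, π (a i) = b i
  · obtain ⟨π, hπ⟩ := hT
    obtain ⟨y, hy⟩ := Ideal.mem_span_singleton'.1 w.2
    have hC : μ.parts.sup < n - (Finset.univ.map b).card := by
      simpa only [Finset.card_map, Finset.card_univ, Fintype.card_fin] using hμ
    have h0 := fixSum_mul_mul_colAntisymmetrizer_eq_zero (Finset.univ.map b) hC
      (MonoidAlgebra.of ℂ _ π * y * rowSymmetrizer ℂ μ)
    rw [cosetSum_eq_fixSum_mul_of a b hπ, ← hy]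
    simp only [youngSymmetrizer, mul_assoc] at h0 ⊢
    exact h0
  · have hempty : Finset.univ.filter (fun σ : Equiv.Perm (Fin n) => ∀ i, σ (a i) = b i) = ∅ :=
      Finset.filter_eq_empty_iff.2 fun σ _ h => hT ⟨σ, h⟩
    rw [hempty, Finset.sum_empty, zero_mul]

/-! ### `V_k ≤ V`: every minimal left ideal `m ≅ S^μ` with `μ₁ ≥ n - k` lies in `V` -/

/-- Intertwining maps between representations on `ℂ[G]`-modules given by left multiplication are
`ℂ[G]`-linear (the translation between Mathlib's `Representation.IntertwiningMap` and the
"isomorphic submodules of `ℝ[G]`" of the paper). [folklore] -/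
theorem intertwiningMap_map_smul {G : Type*} [Group G] {V W : Type*}
    [AddCommGroup V] [Module ℂ V] [Module (MonoidAlgebra ℂ G) V]
    [IsScalarTower ℂ (MonoidAlgebra ℂ G) V]
    [AddCommGroup W] [Module ℂ W] [Module (MonoidAlgebra ℂ G) W]
    [IsScalarTower ℂ (MonoidAlgebra ℂ G) W]
    {ρ : Representation ℂ G V} {σ : Representation ℂ G W}
    (hρ : ∀ (g : G) (v : V), ρ g v = MonoidAlgebra.of ℂ G g • v)
    (hσ : ∀ (g : G) (w : W), σ g w = MonoidAlgebra.of ℂ G g • w)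
    (φ : ρ.IntertwiningMap σ) (x : MonoidAlgebra ℂ G) (v : V) :
    φ (x • v) = x • φ v := by
  induction x using MonoidAlgebra.induction_on with
  | hM g => rw [← hρ, ← hσ, φ.isIntertwining]
  | hadd x y hx hy => rw [add_smul, map_add, hx, hy, add_smul]
  | hsmul r x hx => rw [smul_assoc, map_smul, hx, smul_assoc]

/-- The first row of the canonical tableau of `μ` has at least `μ.parts.sup` (`= μ₁`) entries.
[folklore] -/
theorem sup_parts_le_card_filter_rowOf_eq_zero (μ : Nat.Partition n) :
    μ.parts.sup ≤ (Finset.univ.filter fun j : Fin n => μ.rowOf j = 0).card := by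
  rw [card_filter_rowOf_eq]
  refine Multiset.sup_le.2 fun p hp => ?_
  obtain ⟨i, hi, rfl⟩ := List.mem_iff_getElem.1 ((Multiset.mem_sort _).2 hp : p ∈ μ.sortedParts)
  have h0 : 0 < μ.sortedParts.length := lt_of_le_of_lt (Nat.zero_le i) hi
  rw [List.getD_eq_getElem _ _ h0]
  exact μ.sortedGE_sortedParts (show (⟨0, h0⟩ : Fin _) ≤ ⟨i, hi⟩ from Nat.zero_le i)

/-- A permutation fixing `C` pointwise permutes `Cᶜ`; if `Cᶜ` lies in the first row of `T_μ`, it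
is a row permutation. [folklore] -/
theorem mem_rowStabilizer_of_fix (μ : Nat.Partition n) (C : Finset (Fin n))
    (hrow : ∀ x ∉ C, μ.rowOf x = 0) {σ : Equiv.Perm (Fin n)} (hσ : ∀ x ∈ C, σ x = x) :
    σ ∈ rowStabilizer μ := by
  intro i
  by_cases hi : i ∈ C
  · rw [hσ i hi]
  · have hσi : σ i ∉ C := by
      intro h
      have h2 : σ i = i := σ.injective (hσ (σ i) h)
      rw [h2] at h
      exact hi h
    rw [hrow i hi, hrow (σ i) hσi]

/-- `[Fix C] · a_μ = |Fix C| a_μ` when `Fix C ≤ R_μ`, by the left absorption `p · a_μ = a_μ`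
for `p ∈ R_μ` (Fulton–Harris, Lemma 4.21 (1)). [cite: FultonHarrisGTM129, Lemma 4.21 (1)] -/
theorem fixSum_mul_rowSymmetrizer (C : Finset (Fin n)) {μ : Nat.Partition n}
    (hC : ∀ σ : Equiv.Perm (Fin n), (∀ x ∈ C, σ x = x) → σ ∈ rowStabilizer μ) :
    (∑ σ ∈ Finset.univ.filter (fun σ : Equiv.Perm (Fin n) => ∀ x ∈ C, σ x = x),
        MonoidAlgebra.of ℂ _ σ) * rowSymmetrizer ℂ μ =
      ((Finset.univ.filter fun σ : Equiv.Perm (Fin n) => ∀ x ∈ C, σ x = x).card : ℂ) •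
        rowSymmetrizer ℂ μ := by
  -- left absorption `p · a_μ = a_μ` (companion of the tree's `rowSymmetrizer_mul_of`)
  have habs : ∀ {p : Equiv.Perm (Fin n)}, p ∈ rowStabilizer μ →
      MonoidAlgebra.of ℂ _ p * rowSymmetrizer ℂ μ = rowSymmetrizer ℂ μ := by
    intro p hp
    unfold rowSymmetrizer
    rw [Finset.mul_sum]
    refine Finset.sum_equiv (Equiv.mulLeft p) (fun σ => ?_) (fun σ _ => ?_)
    · simp only [Equiv.coe_mulLeft, Set.mem_toFinset, SetLike.mem_coe]
      exact ⟨fun h => mul_mem hp h, fun h => by simpa using mul_mem (inv_mem hp) h⟩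
    · rw [Equiv.coe_mulLeft, map_mul]
  rw [Finset.sum_mul, Finset.sum_congr rfl fun σ hσ => habs (hC σ (Finset.mem_filter.1 hσ).2),
    Finset.sum_const, ← Nat.cast_smul_eq_nsmul ℂ]

/-- **`V_k ≤ V`** (Ellis–Friedgut–Pilpel, proof of Thm. 7, second half, in the form of the
"alternative proof": `V_{[λ]} ≤ V` for every `λ` with `λ₁ ≥ n - k`, and
`V_k = ⊕_{λ₁ ≥ n-k} V_{[λ]}`). `ℂ[𝔖ₙ]` is the sum of its minimal left ideals `m` (Maschke), each
`≅ S^μ` (completeness of the Specht modules); `z_f` for `f ∈ V_k` kills those with `μ₁ < n - k`,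
and those with `μ₁ ≥ n - k` lie in the two-sided ideal `V` because the `k`-coset sum `[Fix C]`
(`Cᶜ` = `n - k` entries of the first row of `T_μ`) acts nontrivially on them
(`[Fix C] c_μ = |Fix C| c_μ ≠ 0`) and `m` is minimal. Hence `z_f = z_f · 1 ∈ V`.
[cite: EllisFriedgutPilpel2011, §3.2.3 (proof of Thm. 7, alternative proof)] -/
theorem efpV_le_kCosetSpan (n k : ℕ) (hk : k ≤ n) : efpV n k ≤ kCosetSpan n k := by
  classical
  intro f hf
  rw [mem_efpV_iff] at hf
  -- `z = z_f`, the set `T` of `k`-coset sums, `V` its span, `AV` the left ideal it generates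
  set z : MonoidAlgebra ℂ (Equiv.Perm (Fin n)) :=
    ∑ σ : Equiv.Perm (Fin n), f σ • MonoidAlgebra.of ℂ _ σ with hzdef
  set T : Set (MonoidAlgebra ℂ (Equiv.Perm (Fin n))) :=
    {x : MonoidAlgebra ℂ (Equiv.Perm (Fin n)) | ∃ a b : Fin k ↪ Fin n,
      x = ∑ σ ∈ Finset.univ.filter (fun σ : Equiv.Perm (Fin n) => ∀ i, σ (a i) = b i),
        MonoidAlgebra.of ℂ _ σ} with hTdef
  set V : Submodule ℂ (MonoidAlgebra ℂ (Equiv.Perm (Fin n))) := Submodule.span ℂ T with hVdef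
  set AV : Ideal (MonoidAlgebra ℂ (Equiv.Perm (Fin n))) := Ideal.span T with hAVdef
  -- the hypothesis, in the group algebra: `z` kills `S^μ` for `μ₁ < n - k`
  have hz : ∀ μ : Nat.Partition n, μ.parts.sup < n - k → ∀ w : spechtIdeal ℂ μ, z • w = 0 := by
    intro μ hμ w
    apply Subtype.ext
    rw [Submodule.coe_smul, smul_eq_mul, hzdef, ← coe_fourierSpecht_apply, hf μ hμ,
      LinearMap.zero_apply, Submodule.coe_zero]
  -- it suffices that `z ∈ V`
  suffices hJ : z ∈ V by
    let Z : (Equiv.Perm (Fin n) → ℂ) →ₗ[ℂ] MonoidAlgebra ℂ (Equiv.Perm (Fin n)) :=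
      ∑ σ : Equiv.Perm (Fin n),
        (LinearMap.proj σ : (Equiv.Perm (Fin n) → ℂ) →ₗ[ℂ] ℂ).smulRight (MonoidAlgebra.of ℂ _ σ)
    have hZ : ∀ f' : Equiv.Perm (Fin n) → ℂ,
        Z f' = ∑ σ : Equiv.Perm (Fin n), f' σ • MonoidAlgebra.of ℂ _ σ := fun f' => by
      simp only [Z, LinearMap.sum_apply, LinearMap.smulRight_apply, LinearMap.proj_apply]
    have hZinj : Function.Injective Z := by
      intro f₁ f₂ h
      ext τ
      have := congrArg (fun x : MonoidAlgebra ℂ (Equiv.Perm (Fin n)) => x.coeff τ) h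
      simpa only [hZ, coeff_sum_smul_of] using this
    have hle : V ≤ (kCosetSpan n k).map Z := by
      refine Submodule.span_le.2 ?_
      rintro _ ⟨a, b, rfl⟩
      refine ⟨(kCoset a b).indicator 1, Submodule.subset_span ⟨a, b, rfl⟩, ?_⟩
      rw [hZ, sum_indicator_kCoset_smul_of]
    obtain ⟨f', hf', hff'⟩ := Submodule.mem_map.1 (hle hJ)
    have hff : f' = f := hZinj (by rw [hff', hZ])
    rw [← hff]
    exact hf'
  -- Maschke: `ℂ[𝔖ₙ]` is the sum of its minimal left ideals
  haveI : NeZero (Nat.card (Equiv.Perm (Fin n)) : ℂ) := ⟨Nat.cast_ne_zero.2 Nat.card_pos.ne'⟩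
  set S : Set (Submodule (MonoidAlgebra ℂ (Equiv.Perm (Fin n)))
      (MonoidAlgebra ℂ (Equiv.Perm (Fin n)))) :=
    {m | IsSimpleModule (MonoidAlgebra ℂ (Equiv.Perm (Fin n))) m} with hS
  have h1 : (1 : MonoidAlgebra ℂ (Equiv.Perm (Fin n))) ∈
      ⨆ m : S, (m : Submodule (MonoidAlgebra ℂ (Equiv.Perm (Fin n)))
        (MonoidAlgebra ℂ (Equiv.Perm (Fin n)))) := by
    rw [← sSup_eq_iSup', hS, IsSemisimpleModule.sSup_simples_eq_top]
    exact Submodule.mem_top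
  -- each minimal left ideal is mapped into `V` by `z`
  have key : ∀ m : S, ∀ x ∈ (m : Submodule (MonoidAlgebra ℂ (Equiv.Perm (Fin n)))
      (MonoidAlgebra ℂ (Equiv.Perm (Fin n)))), z * x ∈ V := by
    rintro ⟨m, hm⟩ x hx
    simp only [hS, Set.mem_setOf_eq] at hm
    change x ∈ m at hx
    haveI := hm
    haveI : FiniteDimensional ℂ m :=
      Module.Finite.of_injective (m.subtype.restrictScalars ℂ) Subtype.val_injective
    -- the irreducible representation on `m`, and `m ≅ S^μ`
    let ρm : Representation ℂ (Equiv.Perm (Fin n)) m :=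
      Representation.ofModule' (k := ℂ) (G := Equiv.Perm (Fin n)) m
    let em : ρm.asModule ≃ₗ[MonoidAlgebra ℂ (Equiv.Perm (Fin n))] m :=
      { toFun := ρm.asModuleEquiv
        invFun := ρm.asModuleEquiv.symm
        map_add' := map_add _
        map_smul' := fun x w => by
          rw [Representation.asModuleEquiv_map_smul, asAlgebraHom_ofModule', Algebra.lsmul_coe]
          rfl
        left_inv := ρm.asModuleEquiv.left_inv
        right_inv := ρm.asModuleEquiv.right_inv }
    haveI : ρm.IsIrreducible := by
      rw [Representation.irreducible_iff_isSimpleModule_asModule]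
      exact IsSimpleModule.congr em
    obtain ⟨μ, ⟨e⟩⟩ := exists_equiv_spechtRep_of_isIrreducible_holds (k := ℂ) ρm
    have hρm : ∀ (g : Equiv.Perm (Fin n)) (v : m),
        ρm g v = MonoidAlgebra.of ℂ (Equiv.Perm (Fin n)) g • v := fun g v => by
      rw [MonoidAlgebra.of_apply]
      exact ofModule'_apply (k := ℂ) m g v
    have hsp : ∀ (g : Equiv.Perm (Fin n)) (v : spechtIdeal ℂ μ),
        spechtRep ℂ μ g v = MonoidAlgebra.of ℂ (Equiv.Perm (Fin n)) g • v :=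
      fun g v => Subtype.ext (by rw [spechtRep_apply, Submodule.coe_smul, smul_eq_mul])
    by_cases hμ : μ.parts.sup < n - k
    · -- `z` kills `S^μ`, hence `m`
      have hxm : z • (⟨x, hx⟩ : m) = 0 := by
        apply EquivLike.injective e
        have h := intertwiningMap_map_smul hρm hsp e.toIntertwiningMap z ⟨x, hx⟩
        rw [Representation.Equiv.coe_toIntertwiningMap] at h
        rw [map_zero, h, hz μ hμ]
      have h0 : z * x = 0 := by
        have := congrArg Subtype.val hxm
        simpa only [Submodule.coe_smul, smul_eq_mul, Submodule.coe_zero] using this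
      rw [h0]
      exact zero_mem _
    · -- `μ₁ ≥ n - k`: `m ⊆ V`
      push Not at hμ
      obtain ⟨B, hB, hBcard⟩ := Finset.exists_subset_card_eq
        (le_trans hμ (sup_parts_le_card_filter_rowOf_eq_zero μ))
      set C : Finset (Fin n) := Bᶜ with hCdef
      have hCcard : C.card = k := by
        rw [hCdef, Finset.card_compl, hBcard, Fintype.card_fin]
        omega
      have hrow : ∀ x ∉ C, μ.rowOf x = 0 := fun x hxC => by
        have hxB : x ∈ B := by
          rw [hCdef, Finset.mem_compl, not_not] at hxC
          exact hxC
        exact (Finset.mem_filter.1 (hB hxB)).2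
      -- `[Fix C]` is a `k`-coset sum
      set F : MonoidAlgebra ℂ (Equiv.Perm (Fin n)) :=
        ∑ σ ∈ Finset.univ.filter (fun σ : Equiv.Perm (Fin n) => ∀ x ∈ C, σ x = x),
          MonoidAlgebra.of ℂ _ σ with hFdef
      obtain ⟨a, ha⟩ : ∃ a : Fin k ↪ Fin n, ∀ σ : Equiv.Perm (Fin n),
          (∀ i, σ (a i) = a i) ↔ ∀ x ∈ C, σ x = x := by
        refine ⟨(C.orderEmbOfFin hCcard).toEmbedding, fun σ => ⟨fun h x hxC => ?_, fun h i => ?_⟩⟩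
        · have hxr : x ∈ Set.range (C.orderEmbOfFin hCcard) := by
            rw [Finset.range_orderEmbOfFin]
            exact hxC
          obtain ⟨i, rfl⟩ := hxr
          exact h i
        · exact h _ (Finset.orderEmbOfFin_mem C hCcard i)
      have hF_eq : F = ∑ σ ∈ Finset.univ.filter (fun σ : Equiv.Perm (Fin n) => ∀ i, σ (a i) = a i),
          MonoidAlgebra.of ℂ _ σ := by
        refine Finset.sum_congr ?_ fun _ _ => rfl
        ext σ
        simp only [Finset.mem_filter, Finset.mem_univ, true_and]
        exact (ha σ).symm
      have hFV : F ∈ V := by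
        rw [hF_eq]
        exact Submodule.subset_span ⟨a, a, rfl⟩
      -- `[Fix C] c_μ = |Fix C| c_μ ≠ 0`
      have hstab : ∀ σ : Equiv.Perm (Fin n), (∀ x ∈ C, σ x = x) → σ ∈ rowStabilizer μ :=
        fun σ hσ => mem_rowStabilizer_of_fix μ C hrow hσ
      have hne : F * youngSymmetrizer ℂ μ ≠ 0 := by
        rw [youngSymmetrizer, ← mul_assoc, hFdef, fixSum_mul_rowSymmetrizer C hstab,
          smul_mul_assoc]
        refine smul_ne_zero ?_ (youngSymmetrizer_ne_zero_holds ℂ μ)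
        rw [Nat.cast_ne_zero]
        refine Finset.card_ne_zero.2 ⟨1, ?_⟩
        simp
      -- transport to `m`: `[Fix C]` acts nontrivially on `v = e⁻¹(c_μ) ∈ m`
      set cμ : spechtIdeal ℂ μ := ⟨youngSymmetrizer ℂ μ, youngSymmetrizer_mem_spechtIdeal ℂ μ⟩
        with hcμ
      set v : m := e.symm cμ with hv
      have hv_ne : F * (v : MonoidAlgebra ℂ (Equiv.Perm (Fin n))) ≠ 0 := by
        intro h0
        have h1 : F • v = 0 := Subtype.ext (by
          rw [Submodule.coe_smul, smul_eq_mul, h0, Submodule.coe_zero])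
        have h2 := intertwiningMap_map_smul hρm hsp e.toIntertwiningMap F v
        rw [Representation.Equiv.coe_toIntertwiningMap, h1, map_zero, hv,
          Representation.Equiv.apply_symm_apply] at h2
        apply hne
        have h3 := congrArg Subtype.val h2
        simp only [Submodule.coe_zero, Submodule.coe_smul, smul_eq_mul, hcμ] at h3
        exact h3.symm
      have hvm : F * (v : MonoidAlgebra ℂ (Equiv.Perm (Fin n))) ∈ m := m.smul_mem _ v.2
      have hvAV : F * (v : MonoidAlgebra ℂ (Equiv.Perm (Fin n))) ∈ AV :=
        mem_ideal_span_cosetSums_iff.2 (mul_mem_span_cosetSums_right _ hFV)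
      -- `m` is minimal, so `m ≤ AV`, whose elements are those of `V`
      have hatom : IsAtom m := isSimpleModule_iff_isAtom.1 hm
      have hmle : m ≤ AV := by
        rcases hatom.le_iff.1 (inf_le_left : m ⊓ AV ≤ m) with h | h
        · exfalso
          have hmem : F * (v : MonoidAlgebra ℂ (Equiv.Perm (Fin n))) ∈ m ⊓ AV := ⟨hvm, hvAV⟩
          rw [h, Submodule.mem_bot] at hmem
          exact hv_ne hmem
        · exact inf_eq_left.1 h
      exact mul_mem_span_cosetSums _ (mem_ideal_span_cosetSums_iff.1 (hmle hx))
  -- conclude: `z = z · 1 ∈ V`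
  have h := Submodule.iSup_induction
    (fun m : S => (m : Submodule (MonoidAlgebra ℂ (Equiv.Perm (Fin n)))
      (MonoidAlgebra ℂ (Equiv.Perm (Fin n)))))
    (motive := fun x => z * x ∈ V) h1 key
    (by rw [mul_zero]; exact zero_mem _)
    (fun x y hx hy => by rw [mul_add]; exact add_mem hx hy)
  rwa [mul_one] at h

end EllisFriedgutPilpel2011

/-- **Discharge of `EllisFriedgutPilpel2011_thm7`** (Ellis–Friedgut–Pilpel 2011, Theorem 7:
"`V_k` is spanned by the characteristic functions of the `k`-cosets of `S_n`"), for `k ≤ n`: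
`efpV n k = kCosetSpan n k`, by `EllisFriedgutPilpel2011.kCosetSpan_le_efpV` (`V ≤ V_k`) and
`EllisFriedgutPilpel2011.efpV_le_kCosetSpan` (`V_k ≤ V`), following the paper's group-algebra
("alternative") proof of §3.2.3. [cite: EllisFriedgutPilpel2011, Thm. 7 (§1.2; proof §3.2.3)] -/
theorem EllisFriedgutPilpel2011_thm7_holds : EllisFriedgutPilpel2011_thm7 :=
  fun n k hk => le_antisymm (EllisFriedgutPilpel2011.efpV_le_kCosetSpan n k hk)
    (EllisFriedgutPilpel2011.kCosetSpan_le_efpV n k)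

end Literature.RepresentationTheory.FiniteGroups
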